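import Summits.Parity.GeneralizedHardyLittlewood.Theorems.PrimeLevelFamEdgeMomentsBeyondDiagonalIdentificationAtOne
import Summits.Parity.GeneralizedHardyLittlewood.Theorems.PrimeLevelFamEdgeMomentsBeyondDiagonalTwoOrderWeightBounds
import HarnessLib

/-!
# Route `PrimeLevelFamEdge`, crux K_A `MomentsBeyondDiagonal` (stmt-Parity-20007), line «petersson_layers» v4:
# THE OFF-BOX SERIES AT ORDERS `(i, j)` — pairs `(n₁,n₂)` outside the AFE box, with the two-order weight `W_{ij}`

Port of `norm_offBoxTsum_le` (`…IdentificationAtOne` §2, p634139; the case `i = j = 0`, where `W = W₀₀` decays like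
`e^{−π√q}` off the box) to every pair of orders. The two-order weight has polynomial decay of every order
(`norm_afeW_le_rpow`); with `A = 9` and `ε(i+j) ≤ 1/2` this gives the off-box weight step `weight₂_offBox_le`:
`(n₁n₂)^{−1/2} ‖W_{ij}(q̂;n₁,n₂)‖ (n₁n₂) ≤ K_{ij} (1+log q̂)^{i+j} q̂^{−6} n₁^{−2} n₂^{−2}` for `n₁n₂ ≥ q²`, `q ≥ 64` — enough
against `q̂ S² ≤ q̂^{1+93/20}`. Result `norm_offBoxTsum₂_le`: the `(i,j)` off-box series is `≤ A'_P (1+log q̂)^{i+j}` — the second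
of the two per-order estimates the general-`Q` identification `stub_identP` needs after `…TwoOrderGap` / `…TwoOrderBoxError`.
Proof only; nothing about Landau–Siegel zeros; K_A NOT proved.
-/

noncomputable section

open scoped Real Nat
open Complex Finset Polynomial CongruenceSubgroup MeasureTheory
open Literature.NumberTheory.EllipticCurves.ModularForms
open Literature.NumberTheory.LFunctions

namespace Summit.Parity.GeneralizedHardyLittlewood.Theorems.MomentsBeyondDiagonal.TwoOrderAFE

open Summit.Parity.GeneralizedHardyLittlewood.Theorems.PrimeLevelFamEdgeIdeaDeltas.PeterssonLayers

/-- **The two-order weight off the box**: there is `K ≥ 0` (depending on `i, j`) such that for `q ≥ 64`, `n₁, n₂ ≥ 1` with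
`q² ≤ n₁n₂`: `(n₁n₂)^{−1/2} ‖W_{ij}(q̂;n₁,n₂)‖ (n₁n₂)^1 ≤ K (1+log q̂)^{i+j} q̂^{−6} n₁^{−2} n₂^{−2}`
(`norm_afeW_le_rpow` at `A = 9`, `ε = 1/(2(i+j)+2)`; `(n₁n₂)^{−6} ≤ q^{−12} ≤ q̂^{−24}`).
[cite: KowalskiMichelVanderKam2000, (22) p. 12 and (15) p. 9] -/
theorem weight₂_offBox_le (i j : ℕ) :
    ∃ K : ℝ, 0 ≤ K ∧ ∀ {q : ℕ} [NeZero q], 64 ≤ q → ∀ {n₁ n₂ : ℕ}, n₁ ≠ 0 → n₂ ≠ 0 →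
      ((q : ℝ)) ^ 2 ≤ (n₁ : ℝ) * n₂ →
        ((n₁ : ℝ) * n₂) ^ (-(1 / 2 : ℝ)) * ‖KMV2000.afeW (KMV2000.qhat q) i j n₁ n₂‖ * (((n₁ : ℝ) * n₂) ^ (1 : ℝ)) ≤
          K * (1 + Real.log (KMV2000.qhat q)) ^ (i + j) * KMV2000.qhat q ^ (-(6 : ℝ)) *
            (((n₁ : ℝ)) ^ (-(2 : ℝ)) * ((n₂ : ℝ)) ^ (-(2 : ℝ))) := by
  set ε : ℝ := 1 / (2 * ((i : ℝ) + j) + 2) with hεdef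
  have hε : 0 < ε := by rw [hεdef]; positivity
  set K₀ : ℝ := ((∫ x in Set.Ioi (0 : ℝ), x ^ (9 : ℝ) * (Real.exp (-x) * (2 ^ i * (1 + |Real.log x| ^ i)))) *
    ∫ x in Set.Ioi (0 : ℝ), x ^ (9 : ℝ) * (Real.exp (-x) * (2 ^ j * (1 + |Real.log x| ^ j)))) *
    (1 + ε⁻¹) ^ (i + j) with hK₀
  have hK₀0 : 0 ≤ K₀ := by
    have h1 : 0 ≤ ∫ x in Set.Ioi (0 : ℝ), x ^ (9 : ℝ) * (Real.exp (-x) * (2 ^ i * (1 + |Real.log x| ^ i))) :=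
      setIntegral_nonneg measurableSet_Ioi fun x hx ↦ by have hx : (0 : ℝ) < x := hx; positivity
    have h2 : 0 ≤ ∫ x in Set.Ioi (0 : ℝ), x ^ (9 : ℝ) * (Real.exp (-x) * (2 ^ j * (1 + |Real.log x| ^ j))) :=
      setIntegral_nonneg measurableSet_Ioi fun x hx ↦ by have hx : (0 : ℝ) < x := hx; positivity
    have h3 : 0 ≤ (1 + ε⁻¹) ^ (i + j) := pow_nonneg (by positivity) _
    exact mul_nonneg (mul_nonneg h1 h2) h3
  refine ⟨K₀, hK₀0, fun {q} _ h64 {n₁ n₂} h₁ h₂ hout ↦ ?_⟩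
  have hqh1 : 1 < KMV2000.qhat q := one_lt_qhat h64
  have hqh0 : 0 < KMV2000.qhat q := zero_lt_one.trans hqh1
  have hn₁0 : (0 : ℝ) < n₁ := by exact_mod_cast Nat.pos_of_ne_zero h₁
  have hn₂0 : (0 : ℝ) < n₂ := by exact_mod_cast Nat.pos_of_ne_zero h₂
  have hn₁1 : (1 : ℝ) ≤ n₁ := by exact_mod_cast Nat.one_le_iff_ne_zero.mpr h₁
  have hn₂1 : (1 : ℝ) ≤ n₂ := by exact_mod_cast Nat.one_le_iff_ne_zero.mpr h₂
  have hN : (0 : ℝ) < (n₁ : ℝ) * n₂ := mul_pos hn₁0 hn₂0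
  have hq0 : (0 : ℝ) < q := by exact_mod_cast lt_of_lt_of_le (by norm_num : 0 < 64) h64
  have hW := norm_afeW_le_rpow hqh1.le i j (by norm_num : (0 : ℝ) ≤ 9) hε h₁ h₂
  have hL0 : 0 ≤ (1 + Real.log (KMV2000.qhat q)) ^ (i + j) := pow_nonneg (by linarith [Real.log_nonneg hqh1.le]) _
  -- `n^{ε i} ≤ n^{1/2}` (`ε i ≤ 1/2`)
  have hεi : ε * i ≤ 1 / 2 := by
    rw [hεdef]
    have hi : (0 : ℝ) ≤ i := Nat.cast_nonneg i
    have hj : (0 : ℝ) ≤ j := Nat.cast_nonneg j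
    rw [div_mul_eq_mul_div, one_mul, div_le_iff₀ (by positivity)]
    linarith
  have hεj : ε * j ≤ 1 / 2 := by
    rw [hεdef]
    have hi : (0 : ℝ) ≤ i := Nat.cast_nonneg i
    have hj : (0 : ℝ) ≤ j := Nat.cast_nonneg j
    rw [div_mul_eq_mul_div, one_mul, div_le_iff₀ (by positivity)]
    linarith
  have hp₁ : (n₁ : ℝ) ^ (ε * i) ≤ (n₁ : ℝ) ^ (1 / 2 : ℝ) := Real.rpow_le_rpow_of_exponent_le hn₁1 hεi
  have hp₂ : (n₂ : ℝ) ^ (ε * j) ≤ (n₂ : ℝ) ^ (1 / 2 : ℝ) := Real.rpow_le_rpow_of_exponent_le hn₂1 hεj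
  have hp : (n₁ : ℝ) ^ (ε * i) * (n₂ : ℝ) ^ (ε * j) ≤ ((n₁ : ℝ) * n₂) ^ (1 / 2 : ℝ) := by
    rw [Real.mul_rpow hn₁0.le hn₂0.le]
    exact mul_le_mul hp₁ hp₂ (Real.rpow_nonneg hn₂0.le _) (Real.rpow_nonneg hn₁0.le _)
  -- `(q̂²/(n₁n₂))^9 = q̂^{18} (n₁n₂)^{-9}`
  have e1 : (KMV2000.qhat q ^ 2 / ((n₁ : ℝ) * n₂)) ^ (9 : ℝ) = KMV2000.qhat q ^ (18 : ℝ) * ((n₁ : ℝ) * n₂) ^ (-(9 : ℝ)) := by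
    rw [Real.div_rpow (pow_nonneg hqh0.le 2) hN.le, Real.rpow_neg hN.le, div_eq_mul_inv,
      ← Real.rpow_natCast (KMV2000.qhat q) 2, ← Real.rpow_mul hqh0.le]
    norm_num
  -- `(n₁n₂)^{-6} ≤ q^{-12} ≤ q̂^{-24}`
  have h6 : ((n₁ : ℝ) * n₂) ^ (-(6 : ℝ)) ≤ KMV2000.qhat q ^ (-(24 : ℝ)) := by
    have h1 : ((n₁ : ℝ) * n₂) ^ (-(6 : ℝ)) ≤ (((q : ℝ)) ^ 2) ^ (-(6 : ℝ)) :=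
      Real.rpow_le_rpow_of_nonpos (by positivity) hout (by norm_num)
    refine h1.trans ?_
    rw [← Real.rpow_natCast (q : ℝ) 2, ← Real.rpow_mul hq0.le, show ((2 : ℕ) : ℝ) * -(6 : ℝ) = -(12 : ℝ) by norm_num]
    have h3 := level_rpow_neg_le (q := q) (s := 12) (by norm_num)
    rw [show (2 * (12 : ℝ)) = 24 by norm_num] at h3
    exact h3
  -- the product of the `n`-powers
  have e2 : ((n₁ : ℝ) * n₂) ^ (-(1 / 2 : ℝ)) * ((n₁ : ℝ) * n₂) ^ (-(9 : ℝ)) * ((n₁ : ℝ) * n₂) ^ (1 / 2 : ℝ) *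
      ((n₁ : ℝ) * n₂) ^ (1 : ℝ) = ((n₁ : ℝ) * n₂) ^ (-(6 : ℝ)) * (((n₁ : ℝ)) ^ (-(2 : ℝ)) * ((n₂ : ℝ)) ^ (-(2 : ℝ))) := by
    rw [← Real.mul_rpow hn₁0.le hn₂0.le, ← Real.rpow_add hN, ← Real.rpow_add hN, ← Real.rpow_add hN,
      ← Real.rpow_add hN]
    norm_num
  have hr0 : 0 ≤ ((n₁ : ℝ) * n₂) ^ (-(1 / 2 : ℝ)) := Real.rpow_nonneg hN.le _
  have h10 : 0 ≤ ((n₁ : ℝ) * n₂) ^ (1 : ℝ) := Real.rpow_nonneg hN.le _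
  set C₉ : ℝ := (∫ x in Set.Ioi (0 : ℝ), x ^ (9 : ℝ) * (Real.exp (-x) * (2 ^ i * (1 + |Real.log x| ^ i)))) *
    ∫ x in Set.Ioi (0 : ℝ), x ^ (9 : ℝ) * (Real.exp (-x) * (2 ^ j * (1 + |Real.log x| ^ j))) with hC₉
  have hC₉0 : 0 ≤ C₉ :=
    mul_nonneg (setIntegral_nonneg measurableSet_Ioi fun x hx ↦ by have hx : (0 : ℝ) < x := hx; positivity)
      (setIntegral_nonneg measurableSet_Ioi fun x hx ↦ by have hx : (0 : ℝ) < x := hx; positivity)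
  have hpre : 0 ≤ C₉ * (1 + ε⁻¹) ^ (i + j) * (1 + Real.log (KMV2000.qhat q)) ^ (i + j) *
      (KMV2000.qhat q ^ 2 / ((n₁ : ℝ) * n₂)) ^ (9 : ℝ) :=
    mul_nonneg (mul_nonneg (mul_nonneg hC₉0 (pow_nonneg (by positivity) _)) hL0) (Real.rpow_nonneg (by positivity) _)
  calc ((n₁ : ℝ) * n₂) ^ (-(1 / 2 : ℝ)) * ‖KMV2000.afeW (KMV2000.qhat q) i j n₁ n₂‖ * ((n₁ : ℝ) * n₂) ^ (1 : ℝ)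
      ≤ ((n₁ : ℝ) * n₂) ^ (-(1 / 2 : ℝ)) * (C₉ * (1 + ε⁻¹) ^ (i + j) * (1 + Real.log (KMV2000.qhat q)) ^ (i + j) *
          ((KMV2000.qhat q ^ 2 / ((n₁ : ℝ) * n₂)) ^ (9 : ℝ) * ((n₁ : ℝ) * n₂) ^ (1 / 2 : ℝ))) *
          ((n₁ : ℝ) * n₂) ^ (1 : ℝ) := by
        refine mul_le_mul_of_nonneg_right (mul_le_mul_of_nonneg_left (hW.trans ?_) hr0) h10
        have := mul_le_mul_of_nonneg_left hp hpre
        calc C₉ * (1 + ε⁻¹) ^ (i + j) * (1 + Real.log (KMV2000.qhat q)) ^ (i + j) *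
              ((KMV2000.qhat q ^ 2 / ((n₁ : ℝ) * n₂)) ^ (9 : ℝ) * ((n₁ : ℝ) ^ (ε * i) * (n₂ : ℝ) ^ (ε * j)))
            = C₉ * (1 + ε⁻¹) ^ (i + j) * (1 + Real.log (KMV2000.qhat q)) ^ (i + j) *
              (KMV2000.qhat q ^ 2 / ((n₁ : ℝ) * n₂)) ^ (9 : ℝ) * ((n₁ : ℝ) ^ (ε * i) * (n₂ : ℝ) ^ (ε * j)) := by ring
          _ ≤ C₉ * (1 + ε⁻¹) ^ (i + j) * (1 + Real.log (KMV2000.qhat q)) ^ (i + j) *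
              (KMV2000.qhat q ^ 2 / ((n₁ : ℝ) * n₂)) ^ (9 : ℝ) * ((n₁ : ℝ) * n₂) ^ (1 / 2 : ℝ) := this
          _ = _ := by ring
    _ = K₀ * (1 + Real.log (KMV2000.qhat q)) ^ (i + j) * KMV2000.qhat q ^ (18 : ℝ) *
          (((n₁ : ℝ) * n₂) ^ (-(1 / 2 : ℝ)) * ((n₁ : ℝ) * n₂) ^ (-(9 : ℝ)) * ((n₁ : ℝ) * n₂) ^ (1 / 2 : ℝ) *
            ((n₁ : ℝ) * n₂) ^ (1 : ℝ)) := by rw [e1, hK₀]; ring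
    _ = K₀ * (1 + Real.log (KMV2000.qhat q)) ^ (i + j) * (KMV2000.qhat q ^ (18 : ℝ) * ((n₁ : ℝ) * n₂) ^ (-(6 : ℝ))) *
          (((n₁ : ℝ)) ^ (-(2 : ℝ)) * ((n₂ : ℝ)) ^ (-(2 : ℝ))) := by rw [e2]; ring
    _ ≤ K₀ * (1 + Real.log (KMV2000.qhat q)) ^ (i + j) * (KMV2000.qhat q ^ (18 : ℝ) * KMV2000.qhat q ^ (-(24 : ℝ))) *
          (((n₁ : ℝ)) ^ (-(2 : ℝ)) * ((n₂ : ℝ)) ^ (-(2 : ℝ))) := by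
        have hK1 : 0 ≤ K₀ * (1 + Real.log (KMV2000.qhat q)) ^ (i + j) := mul_nonneg hK₀0 hL0
        have hnn : 0 ≤ ((n₁ : ℝ)) ^ (-(2 : ℝ)) * ((n₂ : ℝ)) ^ (-(2 : ℝ)) :=
          mul_nonneg (Real.rpow_nonneg hn₁0.le _) (Real.rpow_nonneg hn₂0.le _)
        have h18 : 0 ≤ KMV2000.qhat q ^ (18 : ℝ) := Real.rpow_nonneg hqh0.le _
        exact mul_le_mul_of_nonneg_right (mul_le_mul_of_nonneg_left (mul_le_mul_of_nonneg_left h6 h18) hK1) hnn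
    _ = _ := by rw [← Real.rpow_add hqh0]; norm_num

set_option maxHeartbeats 400000 in
/-- **THE OFF-BOX SERIES AT ORDERS `(i,j)` is bounded by `A'_P (1+log q̂)^{i+j}`.** For `q` prime `≥ 64` and `0 < Δ' ≤ 3/2`,
the pairs outside the AFE box contribute at most `A'_P (1 + log q̂)^{i+j}` to the two-order dictionary series (port of
`norm_offBoxTsum_le`, weight step `weight₂_offBox_le`). [cite: KowalskiMichelVanderKam2000, (21)–(22) p. 12 and (15) p. 9] -/
theorem norm_offBoxTsum₂_le (P : ℝ[X]) (i j : ℕ) :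
    ∃ A' : ℝ, 0 ≤ A' ∧ ∀ (q : ℕ) [NeZero q], q.Prime → 64 ≤ q → ∀ Δ' : ℝ, 0 < Δ' → Δ' ≤ 3 / 2 →
      ‖∑' x : {n : ℕ × ℕ // n ∉ afeBox q ×ˢ afeBox q},
          ((1 + (-1 : ℂ) ^ (i + j)) * (KMV2000.qhat q : ℂ) *
            (((((x.1.1 : ℝ) * x.1.2) ^ (-(1 / 2 : ℝ)) : ℝ) : ℂ) * KMV2000.afeW (KMV2000.qhat q) i j x.1.1 x.1.2 *
            ∑ m₁ ∈ Icc 1 ⌊KMV2000.qhat q ^ Δ'⌋₊, ∑ m₂ ∈ Icc 1 ⌊KMV2000.qhat q ^ Δ'⌋₊,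
              (KMV2000.mollifierCoeff P (KMV2000.qhat q ^ Δ') m₁ : ℂ) *
                (KMV2000.mollifierCoeff P (KMV2000.qhat q ^ Δ') m₂ : ℂ) *
              ∑ d₁ ∈ (Nat.gcd m₁ x.1.1).divisors, ∑ d₂ ∈ (Nat.gcd m₂ x.1.2).divisors,
                KowalskiMichel2000.pet q (m₁ * x.1.1 / d₁ ^ 2) (m₂ * x.1.2 / d₂ ^ 2)))‖ ≤
        A' * (1 + Real.log (KMV2000.qhat q)) ^ (i + j) := by
  obtain ⟨Kw, hKw0, hKw⟩ := weight₂_offBox_le i j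
  obtain ⟨K, hK0, hK⟩ := exists_norm_pet_le
  obtain ⟨C, hC1, hC⟩ :=
    Literature.NumberTheory.Sieve.exists_card_divisors_le_mul_rpow' (by norm_num : (0 : ℝ) < 1 / 20)
  have hC0 : 0 ≤ C := zero_le_one.trans hC1
  set B : ℝ := ∑ i ∈ range (P.natDegree + 1), |P.coeff i| with hBdef
  have hB : ∀ t ∈ Set.Icc (0 : ℝ) 1, |P.eval t| ≤ B := fun t ht ↦ abs_eval_le_sum_abs_coeff P ht
  have hZ4s : Summable (fun n : ℕ × ℕ ↦ ((n.1 : ℝ)) ^ (-(2 : ℝ)) * ((n.2 : ℝ)) ^ (-(2 : ℝ))) :=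
    summable_prod_rpow (by norm_num)
  set Z₄ : ℝ := ∑' n : ℕ × ℕ, ((n.1 : ℝ)) ^ (-(2 : ℝ)) * ((n.2 : ℝ)) ^ (-(2 : ℝ)) with hZ₄
  have hZ₄0 : 0 ≤ Z₄ := tsum_nonneg fun n ↦ mul_nonneg (Real.rpow_nonneg (Nat.cast_nonneg _) _)
    (Real.rpow_nonneg (Nat.cast_nonneg _) _)
  refine ⟨2 * ((1 + K) * B ^ 2 * C ^ 2) * Kw * Z₄, by positivity,
    fun q _ hq h64 Δ' h0 h32 ↦ ?_⟩
  set L : ℝ := (1 + Real.log (KMV2000.qhat q)) ^ (i + j) with hLdef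
  obtain ⟨hM1, hM32, hMq⟩ := mollifierLength_facts h64 h0 h32
  have hqh1 : 1 < KMV2000.qhat q := one_lt_qhat h64
  have hqh0 : 0 < KMV2000.qhat q := zero_lt_one.trans hqh1
  have hq0 : (0 : ℝ) < q := by exact_mod_cast hq.pos
  set M : ℝ := KMV2000.qhat q ^ Δ' with hMdef
  set S : ℝ := ∑ m ∈ Icc 1 ⌊M⌋₊, ((m : ℝ)) ^ (1 - 1 / 2 + 1 / 20 : ℝ) with hSdef
  have hS0 : 0 ≤ S := Finset.sum_nonneg fun m _ ↦ Real.rpow_nonneg (Nat.cast_nonneg _) _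
  have hSle : S ≤ M ^ (31 / 20 : ℝ) := by
    have h := sum_Icc_rpow_le (M := M) (e := 11 / 20) hM1.le (by norm_num)
    have e1 : (1 - 1 / 2 + 1 / 20 : ℝ) = 11 / 20 := by norm_num
    have e2 : (11 / 20 + 1 : ℝ) = 31 / 20 := by norm_num
    rw [hSdef, e1]; rw [e2] at h; exact h
  -- the majorant constant `D` and its size
  have hL0 : 0 ≤ L := pow_nonneg (by linarith [Real.log_nonneg hqh1.le]) _
  set D : ℝ := 2 * KMV2000.qhat q * ((1 + K) * B ^ 2 * C ^ 2 * S ^ 2) *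
    (Kw * L * KMV2000.qhat q ^ (-(6 : ℝ))) with hDdef
  have hD0 : 0 ≤ D := by positivity
  have hDle : D ≤ 2 * ((1 + K) * B ^ 2 * C ^ 2) * Kw * L := by
    have hS2 : S ^ 2 ≤ KMV2000.qhat q ^ (93 / 20 : ℝ) := by
      calc S ^ 2 ≤ (M ^ (31 / 20 : ℝ)) ^ 2 := by gcongr
        _ = KMV2000.qhat q ^ (Δ' * (31 / 10) : ℝ) := by
            rw [hMdef, ← Real.rpow_natCast, ← Real.rpow_mul (Real.rpow_nonneg hqh0.le _),
              ← Real.rpow_mul hqh0.le]; norm_num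
        _ ≤ KMV2000.qhat q ^ (93 / 20 : ℝ) := Real.rpow_le_rpow_of_exponent_le hqh1.le (by nlinarith)
    have hpow : KMV2000.qhat q * S ^ 2 * KMV2000.qhat q ^ (-(6 : ℝ)) ≤ 1 := by
      calc KMV2000.qhat q * S ^ 2 * KMV2000.qhat q ^ (-(6 : ℝ))
          ≤ KMV2000.qhat q ^ (1 : ℝ) * KMV2000.qhat q ^ (93 / 20 : ℝ) * KMV2000.qhat q ^ (-(6 : ℝ)) := by
            rw [Real.rpow_one]; gcongr
        _ = KMV2000.qhat q ^ (-(7 / 20 : ℝ)) := by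
            rw [← Real.rpow_add hqh0, ← Real.rpow_add hqh0]; norm_num
        _ ≤ KMV2000.qhat q ^ (0 : ℝ) := Real.rpow_le_rpow_of_exponent_le hqh1.le (by norm_num)
        _ = 1 := Real.rpow_zero _
    calc D = (2 * ((1 + K) * B ^ 2 * C ^ 2) * Kw * L) *
          (KMV2000.qhat q * S ^ 2 * KMV2000.qhat q ^ (-(6 : ℝ))) := by rw [hDdef]; ring
      _ ≤ (2 * ((1 + K) * B ^ 2 * C ^ 2) * Kw * L) * 1 := by gcongr
      _ = _ := mul_one _
  -- the majorant and the pointwise bound off the box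
  set g : ℕ × ℕ → ℝ := fun n ↦ D * (((n.1 : ℝ)) ^ (-(2 : ℝ)) * ((n.2 : ℝ)) ^ (-(2 : ℝ))) with hgdef
  have hg0 : ∀ n, 0 ≤ g n := fun n ↦ mul_nonneg hD0 (mul_nonneg (Real.rpow_nonneg (Nat.cast_nonneg _) _)
    (Real.rpow_nonneg (Nat.cast_nonneg _) _))
  have hgs : Summable g := hZ4s.mul_left D
  set F : ℕ × ℕ → ℂ := fun n ↦ (1 + (-1 : ℂ) ^ (i + j)) * (KMV2000.qhat q : ℂ) *
      (((((n.1 : ℝ) * n.2) ^ (-(1 / 2 : ℝ)) : ℝ) : ℂ) * KMV2000.afeW (KMV2000.qhat q) i j n.1 n.2 *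
      ∑ m₁ ∈ Icc 1 ⌊M⌋₊, ∑ m₂ ∈ Icc 1 ⌊M⌋₊,
        (KMV2000.mollifierCoeff P M m₁ : ℂ) * (KMV2000.mollifierCoeff P M m₂ : ℂ) *
        ∑ d₁ ∈ (Nat.gcd m₁ n.1).divisors, ∑ d₂ ∈ (Nat.gcd m₂ n.2).divisors,
          KowalskiMichel2000.pet q (m₁ * n.1 / d₁ ^ 2) (m₂ * n.2 / d₂ ^ 2)) with hFdef
  have hpt : ∀ n : ℕ × ℕ, n ∉ afeBox q ×ˢ afeBox q → ‖F n‖ ≤ g n := by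
    intro n hn
    by_cases h0 : n.1 = 0 ∨ n.2 = 0
    · have hr : (((n.1 : ℝ) * n.2) ^ (-(1 / 2 : ℝ)) : ℝ) = 0 := by
        have hz : ((n.1 : ℝ) * n.2) = 0 := by rcases h0 with h | h <;> simp [h]
        rw [hz, Real.zero_rpow (by norm_num)]
      have hF0 : F n = 0 := by rw [hFdef]; simp only; rw [hr]; simp
      rw [hF0, norm_zero]; exact hg0 n
    rw [not_or] at h0
    have h₁ : 1 ≤ n.1 := Nat.one_le_iff_ne_zero.mpr h0.1
    have h₂ : 1 ≤ n.2 := Nat.one_le_iff_ne_zero.mpr h0.2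
    -- off the box: `q² ≤ n₁ n₂`
    have hout : ((q : ℝ)) ^ 2 ≤ (n.1 : ℝ) * n.2 := by
      have hn' : ¬ (n.1 ≤ q ^ 2 ∧ n.2 ≤ q ^ 2) := by
        intro hh
        exact hn (Finset.mem_product.mpr ⟨by rw [afeBox, Finset.mem_Icc]; exact ⟨h₁, hh.1⟩,
          by rw [afeBox, Finset.mem_Icc]; exact ⟨h₂, hh.2⟩⟩)
      have hnat : q ^ 2 ≤ n.1 * n.2 := by
        rcases not_and_or.mp hn' with h | h
        · exact le_trans (by omega) (Nat.le_mul_of_pos_right _ (by omega))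
        · exact le_trans (by omega) (Nat.le_mul_of_pos_left _ (by omega))
      exact_mod_cast hnat
    -- the inner pair sum
    have hinner : ‖∑ m₁ ∈ Icc 1 ⌊M⌋₊, ∑ m₂ ∈ Icc 1 ⌊M⌋₊,
        (KMV2000.mollifierCoeff P M m₁ : ℂ) * (KMV2000.mollifierCoeff P M m₂ : ℂ) *
        ∑ d₁ ∈ (Nat.gcd m₁ n.1).divisors, ∑ d₂ ∈ (Nat.gcd m₂ n.2).divisors,
          KowalskiMichel2000.pet q (m₁ * n.1 / d₁ ^ 2) (m₂ * n.2 / d₂ ^ 2)‖ ≤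
        (1 + K) * B ^ 2 * C ^ 2 * (((n.1 : ℝ) * n.2) ^ (1 : ℝ)) * S ^ 2 := by
      have hG : ∀ m₁ ∈ Icc 1 ⌊M⌋₊, ∀ m₂ ∈ Icc 1 ⌊M⌋₊, ∀ d₁ ∈ (Nat.gcd m₁ n.1).divisors,
          ∀ d₂ ∈ (Nat.gcd m₂ n.2).divisors,
          ‖(fun a b ↦ KowalskiMichel2000.pet q a b) (m₁ * n.1 / d₁ ^ 2) (m₂ * n.2 / d₂ ^ 2)‖ ≤
            (1 + K) * ((((m₁ * n.1 / d₁ ^ 2 : ℕ) : ℝ)) * ((m₂ * n.2 / d₂ ^ 2 : ℕ) : ℝ)) ^ (1 : ℝ) := by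
        intro m₁ hm₁ m₂ hm₂ d₁ hd₁ d₂ hd₂
        have ha : 1 ≤ m₁ * n.1 / d₁ ^ 2 := one_le_mul_div_sq hd₁ (Finset.mem_Icc.mp hm₁).1 h₁
        have hb : 1 ≤ m₂ * n.2 / d₂ ^ 2 := one_le_mul_div_sq hd₂ (Finset.mem_Icc.mp hm₂).1 h₂
        have h := hK q hq _ _ ha hb
        simp only [Real.rpow_one]
        calc ‖KowalskiMichel2000.pet q (m₁ * n.1 / d₁ ^ 2) (m₂ * n.2 / d₂ ^ 2)‖
            ≤ (1 + K) * ((m₁ * n.1 / d₁ ^ 2 : ℕ) : ℝ) * ((m₂ * n.2 / d₂ ^ 2 : ℕ) : ℝ) := h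
          _ = (1 + K) * (((m₁ * n.1 / d₁ ^ 2 : ℕ) : ℝ) * ((m₂ * n.2 / d₂ ^ 2 : ℕ) : ℝ)) := by ring
      have h := norm_mollifierPairSum_le hB hM1 hC (by norm_num : (0 : ℝ) ≤ 1) (by positivity) n.1 n.2
        (fun a b ↦ KowalskiMichel2000.pet q a b) hG
      simpa only using h
    have hwt := hKw h64 h0.1 h0.2 hout
    -- assemble: `‖F n‖ ≤ 2 q̂ · ((n₁n₂)^{-1/2}‖W‖) · ‖inner‖`
    set w : ℝ := ((n.1 : ℝ) * n.2) ^ (-(1 / 2 : ℝ)) * ‖KMV2000.afeW (KMV2000.qhat q) i j n.1 n.2‖ with hwdef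
    have hw0 : 0 ≤ w := mul_nonneg (Real.rpow_nonneg (by positivity) _) (norm_nonneg _)
    have he2 : ‖(1 + (-1 : ℂ) ^ (i + j))‖ ≤ 2 := by
      calc ‖(1 + (-1 : ℂ) ^ (i + j))‖ ≤ ‖(1 : ℂ)‖ + ‖(-1 : ℂ) ^ (i + j)‖ := norm_add_le _ _
        _ = 2 := by rw [norm_pow, norm_neg, norm_one, one_pow]; norm_num
    have hnormF : ‖F n‖ ≤ 2 * KMV2000.qhat q * w *
        ‖∑ m₁ ∈ Icc 1 ⌊M⌋₊, ∑ m₂ ∈ Icc 1 ⌊M⌋₊,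
          (KMV2000.mollifierCoeff P M m₁ : ℂ) * (KMV2000.mollifierCoeff P M m₂ : ℂ) *
          ∑ d₁ ∈ (Nat.gcd m₁ n.1).divisors, ∑ d₂ ∈ (Nat.gcd m₂ n.2).divisors,
            KowalskiMichel2000.pet q (m₁ * n.1 / d₁ ^ 2) (m₂ * n.2 / d₂ ^ 2)‖ := by
      rw [hFdef]
      simp only
      rw [norm_mul, norm_mul, norm_mul, norm_mul, Complex.norm_real, Complex.norm_real, Real.norm_eq_abs,
        Real.norm_eq_abs, abs_of_pos hqh0, abs_of_nonneg (Real.rpow_nonneg (by positivity) _), hwdef]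
      have hI := norm_nonneg (∑ m₁ ∈ Icc 1 ⌊M⌋₊, ∑ m₂ ∈ Icc 1 ⌊M⌋₊,
          (KMV2000.mollifierCoeff P M m₁ : ℂ) * (KMV2000.mollifierCoeff P M m₂ : ℂ) *
          ∑ d₁ ∈ (Nat.gcd m₁ n.1).divisors, ∑ d₂ ∈ (Nat.gcd m₂ n.2).divisors,
            KowalskiMichel2000.pet q (m₁ * n.1 / d₁ ^ 2) (m₂ * n.2 / d₂ ^ 2))
      have hA := norm_nonneg (KMV2000.afeW (KMV2000.qhat q) i j n.1 n.2)
      have hr := Real.rpow_nonneg (show (0 : ℝ) ≤ (n.1 : ℝ) * n.2 by positivity) (-(1 / 2 : ℝ))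
      have := mul_le_mul_of_nonneg_right he2 (mul_nonneg (mul_nonneg (mul_nonneg hqh0.le hr) hA) hI)
      nlinarith [this]
    refine hnormF.trans ?_
    rw [hgdef]
    simp only
    calc 2 * KMV2000.qhat q * w * _
        ≤ 2 * KMV2000.qhat q * w * ((1 + K) * B ^ 2 * C ^ 2 * (((n.1 : ℝ) * n.2) ^ (1 : ℝ)) * S ^ 2) :=
          mul_le_mul_of_nonneg_left hinner (mul_nonneg (by positivity) hw0)
      _ = 2 * KMV2000.qhat q * ((1 + K) * B ^ 2 * C ^ 2 * S ^ 2) * (w * (((n.1 : ℝ) * n.2) ^ (1 : ℝ))) := by ring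
      _ ≤ 2 * KMV2000.qhat q * ((1 + K) * B ^ 2 * C ^ 2 * S ^ 2) *
          (Kw * (1 + Real.log (KMV2000.qhat q)) ^ (i + j) * KMV2000.qhat q ^ (-(6 : ℝ)) *
            (((n.1 : ℝ)) ^ (-(2 : ℝ)) * ((n.2 : ℝ)) ^ (-(2 : ℝ)))) := by
          rw [hwdef]; gcongr
      _ = D * (((n.1 : ℝ)) ^ (-(2 : ℝ)) * ((n.2 : ℝ)) ^ (-(2 : ℝ))) := by rw [hDdef]; ring
  -- summability on the complement and the comparison of the two series
  have hsub : Summable (fun x : {n : ℕ × ℕ // n ∉ afeBox q ×ˢ afeBox q} ↦ ‖F x‖) :=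
    Summable.of_nonneg_of_le (fun _ ↦ norm_nonneg _) (fun x ↦ hpt x.1 x.2) (hgs.subtype _)
  have hcomp : ∑' x : {n : ℕ × ℕ // n ∉ afeBox q ×ˢ afeBox q}, g x ≤ ∑' n, g n := by
    have h : ∑ x ∈ afeBox q ×ˢ afeBox q, g x + ∑' x : {n : ℕ × ℕ // n ∉ afeBox q ×ˢ afeBox q}, g x =
        ∑' n, g n := hgs.sum_add_tsum_compl
    have hnn : 0 ≤ ∑ n ∈ afeBox q ×ˢ afeBox q, g n := Finset.sum_nonneg fun n _ ↦ hg0 n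
    linarith
  have htot : ∑' n, g n = D * Z₄ := by rw [hgdef, hZ₄]; exact tsum_mul_left
  show ‖∑' x : {n : ℕ × ℕ // n ∉ afeBox q ×ˢ afeBox q}, F x‖ ≤ _
  calc ‖∑' x : {n : ℕ × ℕ // n ∉ afeBox q ×ˢ afeBox q}, F x‖
      ≤ ∑' x : {n : ℕ × ℕ // n ∉ afeBox q ×ˢ afeBox q}, ‖F x‖ := norm_tsum_le_tsum_norm hsub
    _ ≤ ∑' x : {n : ℕ × ℕ // n ∉ afeBox q ×ˢ afeBox q}, g x :=
        Summable.tsum_le_tsum (fun x ↦ hpt x.1 x.2) hsub (hgs.subtype _)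
    _ ≤ ∑' n, g n := hcomp
    _ = D * Z₄ := htot
    _ ≤ (2 * ((1 + K) * B ^ 2 * C ^ 2) * Kw * L) * Z₄ := by gcongr
    _ = 2 * ((1 + K) * B ^ 2 * C ^ 2) * Kw * Z₄ * L := by ring

end Summit.Parity.GeneralizedHardyLittlewood.Theorems.MomentsBeyondDiagonal.TwoOrderAFE

end
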